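import Mathlib.RingTheory.PowerSeries.WellKnown
import Mathlib.RingTheory.PowerSeries.Trunc
import Mathlib.Algebra.Polynomial.Div
import Mathlib.Algebra.Polynomial.Eval.Defs
import Mathlib.Data.Int.ModEq
import Mathlib.Algebra.BigOperators.ModEq
import Mathlib.Tactic.Ring
import Mathlib.Tactic.Linarith
import HarnessLib

/-!
# Modulus amplification: a degree-`2ℓ - 1` integer polynomial sending even numbers to `0` and odd numbers to `1` modulo `2^ℓ`

Trunk `CplxCore`, Mathlib only. The arithmetic heart of the second half of Toda's theorem
(`BP·⊕P ⊆ P^{PP}`, Arora–Barak 2009, Thm. 17.14 from Lemma 17.22): a parity count `τ` is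
*amplified* to a count that is `≡ 0` or `≡ const (mod 2^ℓ)` according to the parity of `τ`, so that a
sum of `< 2^ℓ` amplified counts reveals, modulo `2^ℓ`, *how many* of them were odd (`sum_amplified_modEq`).
Arora–Barak (proof of Lemma 17.22) iterate `τ ↦ 4τ³ + 3τ⁴` `log ℓ` times (constant `-1`); Toda (1991,
§4) and Beigel–Tarui (1994, the "modulus amplifying polynomials") give one explicit polynomial of
degree `2ℓ - 1`, which is what we vendor, with constant `+1`:

  `T_ℓ(X) = Σ_{j<ℓ} C(ℓ-1+j, j) X^j`  (the truncation of `(1 - X)^{-ℓ}`),  `A_ℓ(X) = 1 - (1 - X)^ℓ T_ℓ(X)`.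

Since `(1 - X)^ℓ · (1 - X)^{-ℓ} = 1` in `ℤ⟦X⟧` and `T_ℓ` agrees with `(1 - X)^{-ℓ}` below degree `ℓ`,
the coefficients of `A_ℓ` below `ℓ` vanish: `X^ℓ ∣ A_ℓ` (`X_pow_dvd_A`). Hence for even `τ`,
`2^ℓ ∣ τ^ℓ ∣ A_ℓ(τ)`, and for odd `τ`, `2^ℓ ∣ (1 - τ)^ℓ ∣ 1 - A_ℓ(τ)` (`amplify_modEq`:
`A_ℓ(τ) ≡ [τ odd] (mod 2^ℓ)`). The coefficients are *signed* products of binomial coefficients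
(`eval_A_eq_sum`), so `A_ℓ(f)` for `f ∈ #P` is a `GapP` function whose two halves `Apos`, `Aneg`
(`Apos_sub_Aneg`) are realised by witness languages counting subsets and tuples (the consumer file);
no iteration of formulas is needed.

## References

* S. Toda, *PP is as hard as the polynomial-time hierarchy*, SIAM J. Comput. 20 (1991) 865–877, §4.
* R. Beigel, J. Tarui, *On ACC*, Comput. Complexity 4 (1994) 350–366, Lemma (modulus amplifying
  polynomials).
* S. Arora, B. Barak, *Computational Complexity: A Modern Approach*, CUP 2009, Lemma 17.22 and the
  proof of Thm. 17.14 (p. 423).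
-/

namespace Literature.Computability.Complexity

open Polynomial Finset

namespace ModAmp

variable (ℓ : ℕ)

/-! ### The polynomials -/

/-- **`T_ℓ(X) = Σ_{j<ℓ} C(ℓ-1+j, j) X^j`**, the truncation below degree `ℓ` of `(1 - X)^{-ℓ}`.
[Beigel–Tarui 1994, Lemma (modulus amplifying polynomials); Toda 1991, §4] [cite: AroraBarak2009, Lemma 17.22] -/
noncomputable def T : ℤ[X] := ∑ j ∈ range ℓ, C ((ℓ - 1 + j).choose j : ℤ) * X ^ j

/-- **The amplifying polynomial `A_ℓ(X) = 1 - (1 - X)^ℓ T_ℓ(X)`** (degree `2ℓ - 1`).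
[Beigel–Tarui 1994; Toda 1991, §4; Arora–Barak 2009, Lemma 17.22] [cite: AroraBarak2009, Lemma 17.22] -/
noncomputable def A : ℤ[X] := 1 - (1 - X) ^ ℓ * T ℓ

/-- The coefficients of `T_ℓ`. [folklore] -/
theorem coeff_T (n : ℕ) : (T ℓ).coeff n = if n < ℓ then ((ℓ - 1 + n).choose n : ℤ) else 0 := by
  rw [T, finsetSum_coeff]
  simp only [coeff_C_mul_X_pow]
  split_ifs with h
  · rw [sum_eq_single n (fun j _ hj => if_neg (Ne.symm hj)) (fun hn => absurd (mem_range.2 h) hn), if_pos rfl]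
  · exact sum_eq_zero fun j hj => if_neg fun hnj : n = j => h (lt_of_eq_of_lt hnj (mem_range.1 hj))

/-- **`T_ℓ` agrees with `(1 - X)^{-ℓ}` below degree `ℓ`** (`PowerSeries.invOneSubPow`: the series
`Σ C(d+n, d) X^n` is the inverse of `(1 - X)^{d+1}`). [folklore] -/
theorem coeff_T_eq_coeff_mk (d n : ℕ) (hn : n < d + 1) :
    PowerSeries.coeff n (T (d + 1) : PowerSeries ℤ) =
      PowerSeries.coeff n (PowerSeries.mk fun n => ((d + n).choose d : ℤ)) := by
  rw [Polynomial.coeff_coe, coeff_T, if_pos hn, PowerSeries.coeff_mk, Nat.add_sub_cancel, Nat.choose_symm_add]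

/-- **The low coefficients of `(1 - X)^ℓ T_ℓ` are those of `1`.** [Beigel–Tarui 1994, Lemma (proof)]
[cite: AroraBarak2009, Lemma 17.22] -/
theorem coeff_one_sub_pow_mul_T (d n : ℕ) (hn : n < d + 1) :
    ((1 - X) ^ (d + 1) * T (d + 1)).coeff n = if n = 0 then 1 else 0 := by
  -- compute in `ℤ⟦X⟧`, where `(Σ C(d+n,d) Xⁿ) · (1 - X)^{d+1} = 1`
  have hps := PowerSeries.mk_add_choose_mul_one_sub_pow_eq_one (S := ℤ) d
  have hco : PowerSeries.coeff n (((1 - X) ^ (d + 1) * T (d + 1) : ℤ[X]) : PowerSeries ℤ) =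
      PowerSeries.coeff n ((PowerSeries.mk fun n => ((d + n).choose d : ℤ)) * (1 - PowerSeries.X) ^ (d + 1)) := by
    rw [mul_comm, Polynomial.coe_mul, Polynomial.coe_pow, Polynomial.coe_sub, Polynomial.coe_one, Polynomial.coe_X,
      PowerSeries.coeff_mul, PowerSeries.coeff_mul]
    refine sum_congr rfl fun p hp => ?_
    have hp1 : p.1 < d + 1 := by have := Finset.mem_antidiagonal.1 hp; omega
    rw [coeff_T_eq_coeff_mk d p.1 hp1]
  rw [← Polynomial.coeff_coe, hco, hps, PowerSeries.coeff_one]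

/-- **`X^ℓ ∣ A_ℓ`**: the coefficients of `A_ℓ` below `ℓ` vanish. [Beigel–Tarui 1994, Lemma]
[cite: AroraBarak2009, Lemma 17.22] -/
theorem X_pow_dvd_A : X ^ ℓ ∣ A ℓ := by
  rcases ℓ with _ | d
  · simp
  · rw [X_pow_dvd_iff]
    intro n hn
    rw [A, coeff_sub, coeff_one, coeff_one_sub_pow_mul_T d n hn]
    split_ifs <;> simp

/-! ### Values at integers -/

/-- **Even arguments**: `2^ℓ ∣ A_ℓ(τ)` for even `τ` (as `τ^ℓ ∣ A_ℓ(τ)`). [Toda 1991, §4;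
Arora–Barak 2009, Lemma 17.22] [cite: AroraBarak2009, Lemma 17.22] -/
theorem two_pow_dvd_eval_A_of_even {τ : ℤ} (hτ : 2 ∣ τ) : (2 : ℤ) ^ ℓ ∣ (A ℓ).eval τ := by
  obtain ⟨U, hU⟩ := X_pow_dvd_A ℓ
  rw [hU, eval_mul, eval_pow, eval_X]
  exact Dvd.dvd.mul_right (pow_dvd_pow_of_dvd hτ ℓ) _

/-- **Odd arguments**: `2^ℓ ∣ A_ℓ(τ) - 1` for odd `τ` (as `(1 - τ)^ℓ ∣ 1 - A_ℓ(τ)`). [Toda 1991, §4;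
Arora–Barak 2009, Lemma 17.22] [cite: AroraBarak2009, Lemma 17.22] -/
theorem two_pow_dvd_eval_A_sub_one_of_odd {τ : ℤ} (hτ : ¬ 2 ∣ τ) : (2 : ℤ) ^ ℓ ∣ (A ℓ).eval τ - 1 := by
  have h2 : (2 : ℤ) ∣ 1 - τ := by
    rcases Int.even_or_odd τ with h | h
    · exact absurd (even_iff_two_dvd.1 h) hτ
    · obtain ⟨k, rfl⟩ := h; exact ⟨-k, by ring⟩
  rw [A, eval_sub, eval_one, eval_mul, eval_pow, eval_sub, eval_one, eval_X,
    show (1 : ℤ) - (1 - τ) ^ ℓ * (T ℓ).eval τ - 1 = -((1 - τ) ^ ℓ * (T ℓ).eval τ) by ring, dvd_neg]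
  exact Dvd.dvd.mul_right (pow_dvd_pow_of_dvd h2 ℓ) _

/-- **Amplification**: `A_ℓ(τ) ≡ [τ odd] (mod 2^ℓ)`. [Toda 1991, §4; Beigel–Tarui 1994; Arora–Barak
2009, Lemma 17.22 (with constant `+1` in place of `-1`)] [cite: AroraBarak2009, Lemma 17.22] -/
theorem eval_A_modEq (τ : ℤ) : (A ℓ).eval τ ≡ (if 2 ∣ τ then 0 else 1) [ZMOD 2 ^ ℓ] := by
  split_ifs with h
  · exact (Int.modEq_zero_iff_dvd.2 (two_pow_dvd_eval_A_of_even ℓ h))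
  · exact (Int.ModEq.symm ((Int.modEq_iff_dvd).2 (two_pow_dvd_eval_A_sub_one_of_odd ℓ h)))

/-! ### The signed double-sum form and its two halves -/

/-- **The coefficients are signed products of binomial coefficients**:
`A_ℓ(τ) = 1 - Σ_{i ≤ ℓ} Σ_{j < ℓ} (-1)^i C(ℓ, i) C(ℓ-1+j, j) τ^{i+j}`. [Beigel–Tarui 1994, Lemma]
[cite: AroraBarak2009, Lemma 17.22] -/
theorem eval_A_eq_sum (τ : ℤ) : (A ℓ).eval τ =
    1 - ∑ i ∈ range (ℓ + 1), ∑ j ∈ range ℓ,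
      (-1) ^ i * (ℓ.choose i : ℤ) * ((ℓ - 1 + j).choose j : ℤ) * τ ^ (i + j) := by
  rw [A, eval_sub, eval_one, eval_mul, eval_pow, eval_sub, eval_one, eval_X, T, eval_finsetSum]
  simp only [eval_mul, eval_C, eval_pow, eval_X]
  congr 1
  -- expand `(1 - τ)^ℓ` by the binomial theorem and distribute
  rw [sub_eq_add_neg, add_comm, add_pow, sum_mul]
  refine sum_congr rfl fun i _ => ?_
  rw [mul_sum]
  refine sum_congr rfl fun j _ => ?_
  rw [one_pow, mul_one, neg_pow τ i, pow_add]
  ring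

/-- **The positive half** `A⁺_ℓ(τ) = 1 + Σ_{i ≤ ℓ odd} Σ_{j<ℓ} C(ℓ,i) C(ℓ-1+j,j) τ^{i+j}` (a natural
number for `τ ∈ ℕ`). [cite: AroraBarak2009, Lemma 17.22] -/
def Apos (τ : ℕ) : ℕ :=
  1 + ∑ i ∈ (range (ℓ + 1)).filter (fun i => ¬ 2 ∣ i), ∑ j ∈ range ℓ, ℓ.choose i * (ℓ - 1 + j).choose j * τ ^ (i + j)

/-- **The negative half** `A⁻_ℓ(τ) = Σ_{i ≤ ℓ even} Σ_{j<ℓ} C(ℓ,i) C(ℓ-1+j,j) τ^{i+j}`.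
[cite: AroraBarak2009, Lemma 17.22] -/
def Aneg (τ : ℕ) : ℕ :=
  ∑ i ∈ (range (ℓ + 1)).filter (fun i => 2 ∣ i), ∑ j ∈ range ℓ, ℓ.choose i * (ℓ - 1 + j).choose j * τ ^ (i + j)

/-- **`A⁺ - A⁻ = A`** at natural arguments. [cite: AroraBarak2009, Lemma 17.22] -/
theorem Apos_sub_Aneg (τ : ℕ) : (Apos ℓ τ : ℤ) - Aneg ℓ τ = (A ℓ).eval (τ : ℤ) := by
  rw [eval_A_eq_sum, Apos, Aneg]
  push_cast
  rw [← sum_filter_add_sum_filter_not (range (ℓ + 1)) (fun i => 2 ∣ i)]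
  have he : ∀ i ∈ (range (ℓ + 1)).filter (fun i => 2 ∣ i), ∑ j ∈ range ℓ,
      (-1) ^ i * (ℓ.choose i : ℤ) * ((ℓ - 1 + j).choose j : ℤ) * (τ : ℤ) ^ (i + j) =
      ∑ j ∈ range ℓ, (ℓ.choose i : ℤ) * ((ℓ - 1 + j).choose j : ℤ) * (τ : ℤ) ^ (i + j) := by
    intro i hi
    obtain ⟨k, rfl⟩ := (mem_filter.1 hi).2
    refine sum_congr rfl fun j _ => ?_
    rw [pow_mul, neg_one_sq, one_pow, one_mul]
  have ho : ∀ i ∈ (range (ℓ + 1)).filter (fun i => ¬ 2 ∣ i), ∑ j ∈ range ℓ,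
      (-1) ^ i * (ℓ.choose i : ℤ) * ((ℓ - 1 + j).choose j : ℤ) * (τ : ℤ) ^ (i + j) =
      -∑ j ∈ range ℓ, (ℓ.choose i : ℤ) * ((ℓ - 1 + j).choose j : ℤ) * (τ : ℤ) ^ (i + j) := by
    intro i hi
    have hodd : Odd i := Nat.odd_iff.2 (Nat.two_dvd_ne_zero.1 (mem_filter.1 hi).2)
    rw [← sum_neg_distrib]
    refine sum_congr rfl fun j _ => ?_
    rw [hodd.neg_one_pow]
    ring
  rw [sum_congr rfl he, sum_congr rfl ho, sum_neg_distrib]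
  ring

/-- **Amplification of the two halves**: `A⁺_ℓ(τ) - A⁻_ℓ(τ) ≡ [τ odd] (mod 2^ℓ)`.
[Toda 1991, §4; Arora–Barak 2009, Lemma 17.22] [cite: AroraBarak2009, Lemma 17.22] -/
theorem amplify_modEq (τ : ℕ) : (Apos ℓ τ : ℤ) - Aneg ℓ τ ≡ (if Odd τ then 1 else 0) [ZMOD 2 ^ ℓ] := by
  rw [Apos_sub_Aneg]
  have h := eval_A_modEq ℓ (τ : ℤ)
  have hcast : (2 : ℤ) ∣ (τ : ℤ) ↔ 2 ∣ τ := by exact_mod_cast Int.natCast_dvd_natCast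
  by_cases hτ : Odd τ
  · rw [if_pos hτ]
    rwa [if_neg (hcast.not.2 (Nat.two_dvd_ne_zero.2 (Nat.odd_iff.1 hτ)))] at h
  · rw [if_neg hτ]
    rwa [if_pos (hcast.2 (even_iff_two_dvd.1 (Nat.not_odd_iff_even.1 hτ)))] at h

/-- **Summing amplified counts counts the odd ones**: for `τ_r ∈ ℕ`,
`Σ_r (A⁺(τ_r) - A⁻(τ_r)) ≡ #{r | τ_r odd} (mod 2^ℓ)`. (Arora–Barak 2009, proof of Thm. 17.14,
p. 423: "`Σ_r #(T(φ_r)) mod 2^{ℓ}` … reveals the number of `r` with `#(φ_r)` odd".)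
[cite: AroraBarak2009, Thm. 17.14 (proof)] -/
theorem sum_amplified_modEq {ι : Type*} (s : Finset ι) (τ : ι → ℕ) :
    ∑ r ∈ s, ((Apos ℓ (τ r) : ℤ) - Aneg ℓ (τ r)) ≡ ((s.filter fun r => Odd (τ r)).card : ℤ) [ZMOD 2 ^ ℓ] := by
  classical
  rw [← Nat.cast_id (Finset.card _), ← sum_boole]
  push_cast
  exact Int.ModEq.sum fun r _ => amplify_modEq ℓ (τ r)

end ModAmp

end Literature.Computability.Complexity
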